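import Literature.NumberTheory.DiophantineGeometry.CyclotomicDescentSignaturePP2
import HarnessLib

/-!
# The cyclotomic descent for `x ^ r + y ^ r = C z ^ p` ([Freitas2015, §2]): `φ_r(a, b) = c ^ p` or `r c ^ p`

Sibling of `CyclotomicDescentSignaturePP2.lean` (the `(p, p, 2)` descent). Source: N. Freitas, *Recipes to Fermat-type
equations of the form `x^r + y^r = Cz^p`*, Math. Z. 279 (2015) 605–639 [Freitas2015], §2 — the elementary step (0) of the
multi-Frey modular method for signature `(r, r, p)`. With `φ_r(x, y) = (x^r + y^r)/(x + y) = Σ_{i=0}^{r−1} (−1)^i x^{r−1−i} y^i`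
(written below as Mathlib's `∑ i ∈ range r, x ^ i * (-y) ^ (r - 1 - i)`, the same sum read backwards):
* `freitas2015_lemma24` = [Freitas2015, Lemma 2.4] (main clause + second bullet), verbatim: "Let `p` be a prime and
  suppose there exists a primitive solution `(a,b,c')` to `x^r + y^r = C z^p`. Then, there exists `c ∈ ℤ` such that
  `(a,b,c)` is a solution to `φ_r(a,b) = c^p` (A) or `φ_r(a,b) = r c^p` (B), which satisfies `r ∤ a+b` in case (A) and
  `r ∣ a+b` in case (B). Moreover … the prime divisors of `c` are all congruent to `1 (mod r)`. In particular, neither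
  `2`, nor `r` divide `c`." Standing hypotheses (§2.2): `r ≥ 7` prime, `C` divisible only by primes `q ≢ 1 (mod r)`,
  `r ∤ C`; "primitive" = `gcd(a, b) = 1` (Def. 1.6). PROVED for every odd prime `r` and every prime `p`.
* `freitas2015_prop25` = [Freitas2015, Prop. 2.5], verbatim: "Let `r ≥ 5` be a prime. The equations `φ_r(x,y) = 1` and
  `φ_r(x,y) = r` admit only the solutions `±(1,0)`, `±(0,1)`, `±(1,1)` and `±(1,−1)`, respectively."
* NOT formalized: bullets 1 and 3 of Lemma 2.4 (`|abc| > 1`; the shape `a + b = C r^k c₀^p`) and Cor. 2.6.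
Mechanism (sibling file): a prime `ℓ ∣ φ_r(a, b)` is `r` (iff `r ∣ a + b`) or `≡ 1 (mod r)` and then prime to `a + b`
(`prime_dvd_geom_sum₂_int` = [Freitas2015, Prop. 2.3 / Cor. 2.2]); `r² ∤ φ_r(a, b)` (`sq_not_dvd_geom_sum₂_int`); so in
`(a + b)·φ_r(a, b) = C c'^p` the `r`-free part of `φ_r(a, b)` is a positive integer prime to its cofactor, hence a `p`-th
power. Everything PROVED; no new named fact. Literature seat of the venture cell `pub-abcsig` (lit g14), 2026-08-25.
-/

namespace Literature.NumberTheory.DiophantineGeometry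

open Finset

/-- Two integers are coprime as soon as no prime divides both. [folklore] -/
private theorem isCoprime_of_forall_prime' {a b : ℤ}
    (h : ∀ ℓ : ℕ, ℓ.Prime → (ℓ : ℤ) ∣ a → (ℓ : ℤ) ∣ b → False) : IsCoprime a b := by
  rw [Int.isCoprime_iff_gcd_eq_one]
  exact Nat.coprime_of_dvd fun k hk hka hkb => h k hk (Int.natCast_dvd.2 hka) (Int.natCast_dvd.2 hkb)

/-- A prime dividing `Σ_{i<r} x^i y^{r−1−i}` does not divide `y` when `x, y` are coprime. [folklore] -/
private theorem not_dvd_of_prime_dvd_geom_sum₂' {r ℓ : ℕ} (hr : r ≠ 0) (hℓ : ℓ.Prime) {x y : ℤ}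
    (hxy : IsCoprime x y) (hdvd : (ℓ : ℤ) ∣ ∑ i ∈ range r, x ^ i * y ^ (r - 1 - i)) :
    ¬ (ℓ : ℤ) ∣ y := by
  intro hy
  have hℓZ : Prime (ℓ : ℤ) := Nat.prime_iff_prime_int.mp hℓ
  have h1 : (ℓ : ℤ) ∣ x ^ r - y ^ r := by
    rw [← geom_sum₂_mul]; exact dvd_mul_of_dvd_left hdvd _
  have h3 : (ℓ : ℤ) ∣ x ^ r := by simpa using dvd_add h1 (dvd_pow hy hr)
  exact hℓZ.not_unit (hxy.isUnit_of_dvd' (hℓZ.dvd_of_dvd_pow h3) hy)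

/-- `φ_r(a, b)·(a + b) = a^r + b^r` for odd `r`. [folklore] -/
private theorem phi_mul_add {r : ℕ} (hodd : Odd r) (a b : ℤ) :
    (∑ i ∈ range r, a ^ i * (-b) ^ (r - 1 - i)) * (a + b) = a ^ r + b ^ r := by
  have := geom_sum₂_mul a (-b) r
  rwa [hodd.neg_pow, sub_neg_eq_add, sub_neg_eq_add] at this

/-- `φ_r(a, b) > 0` for odd `r` and `a + b ≠ 0` (it has the sign of `(a^r + b^r)/(a + b)`). [folklore] -/
private theorem phi_pos {r : ℕ} (hodd : Odd r) {a b : ℤ} (hab : a + b ≠ 0) :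
    0 < ∑ i ∈ range r, a ^ i * (-b) ^ (r - 1 - i) := by
  set Q := ∑ i ∈ range r, a ^ i * (-b) ^ (r - 1 - i) with hQ
  have hmul : Q * (a + b) = a ^ r + b ^ r := phi_mul_add hodd a b
  have hmono : StrictMono fun t : ℤ => t ^ r := hodd.strictMono_pow
  have hne : a ≠ -b := fun h => hab (by rw [h, neg_add_cancel])
  by_contra hQ0
  have hQle : Q ≤ 0 := not_lt.mp hQ0
  rcases lt_or_gt_of_ne hne with h | h
  · have h1 : a ^ r < (-b) ^ r := hmono h
    rw [hodd.neg_pow] at h1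
    nlinarith [mul_nonneg_of_nonpos_of_nonpos hQle (show a + b ≤ 0 by linarith)]
  · have h1 : (-b) ^ r < a ^ r := hmono h
    rw [hodd.neg_pow] at h1
    nlinarith [mul_nonpos_of_nonpos_of_nonneg hQle (show 0 ≤ a + b by linarith)]

/-- From `A·B = z^p` (`p` prime) with `A, B` coprime and `A > 0`: `A` is a `p`-th power. [folklore] -/
private theorem eq_pow_of_mul_eq_pow_of_pos {A B z : ℤ} {p : ℕ} (hp : p.Prime) (hcop : IsCoprime A B)
    (h : A * B = z ^ p) (hA : 0 < A) : ∃ d : ℤ, A = d ^ p := by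
  rcases hp.eq_two_or_odd' with rfl | hodd
  · obtain ⟨d, hd | hd⟩ := Int.sq_of_isCoprime hcop h
    · exact ⟨d, hd⟩
    · exfalso; nlinarith [sq_nonneg d]
  · exact Int.eq_pow_of_mul_eq_pow_odd_left hcop hodd h

/-- **[Freitas2015, Lemma 2.4]** (the cyclotomic descent for signature `(r, r, p)`), main clause and second bullet,
verbatim in the module docstring: for an odd prime `r` (Freitas: `r ≥ 7`), a prime `p`, an integer `C` divisible
only by primes `q ≢ 1 (mod r)` with `r ∤ C`, and a primitive solution (`gcd(a, b) = 1`) of `a^r + b^r = C c'^p`, there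
is `c ∈ ℤ` with `φ_r(a, b) = c^p` and `r ∤ a + b`, or `φ_r(a, b) = r c^p` and `r ∣ a + b`; every prime divisor of `c`
is `≡ 1 (mod r)` (so `2 ∤ c`, `r ∤ c`). Here `φ_r(a, b) = Σ_{i<r} a^i (−b)^{r−1−i} = (a^r + b^r)/(a + b)`.
[cite: Freitas2015, Lemma 2.4] -/
theorem freitas2015_lemma24 {r p : ℕ} (hr : r.Prime) (hr2 : r ≠ 2) (hp : p.Prime) {C : ℤ}
    (hC : ∀ q : ℕ, q.Prime → (q : ℤ) ∣ C → q % r ≠ 1) (hrC : ¬ (r : ℤ) ∣ C)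
    {a b c' : ℤ} (hab : IsCoprime a b) (heq : a ^ r + b ^ r = C * c' ^ p) :
    ∃ c : ℤ,
      (((∑ i ∈ range r, a ^ i * (-b) ^ (r - 1 - i)) = c ^ p ∧ ¬ (r : ℤ) ∣ a + b) ∨
        ((∑ i ∈ range r, a ^ i * (-b) ^ (r - 1 - i)) = r * c ^ p ∧ (r : ℤ) ∣ a + b)) ∧
      ∀ q : ℕ, q.Prime → (q : ℤ) ∣ c → q % r = 1 := by
  have hodd : Odd r := hr.odd_of_ne_two hr2
  have hrZ : Prime (r : ℤ) := Nat.prime_iff_prime_int.mp hr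
  set φ := ∑ i ∈ range r, a ^ i * (-b) ^ (r - 1 - i) with hφ
  set s := a + b with hs
  have hφmul : φ * s = C * c' ^ p := by rw [hφ, hs, phi_mul_add hodd, heq]
  -- the degenerate line `a + b = 0`: `(a, b) = ±(1, −1)`, `φ = r = r·1^p`
  by_cases hs0 : s = 0
  · have hba : b = -a := by rw [hs] at hs0; linear_combination hs0
    have hunit : IsUnit a := by
      have h := hab; rw [hba, IsCoprime.neg_right_iff, isCoprime_self] at h; exact h
    have hφr : φ = r := by
      rw [hφ, hba, neg_neg, geom_sum₂_self]
      rcases Int.isUnit_iff.mp hunit with rfl | rfl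
      · rw [one_pow, mul_one]
      · rw [(Nat.Prime.even_sub_one hr hr2).neg_one_pow, mul_one]
    refine ⟨1, Or.inr ⟨by rw [hφr, one_pow, mul_one], by rw [hs0]; exact dvd_zero _⟩, ?_⟩
    intro q hq hq1
    have h1 : q ∣ 1 := Int.natCast_dvd_natCast.mp (by simpa using hq1)
    exact absurd (Nat.dvd_one.mp h1) hq.one_lt.ne'
  -- from here on `a + b ≠ 0`, so `φ > 0`
  have hφpos : 0 < φ := phi_pos hodd hs0
  have hab' : IsCoprime a (-b) := hab.neg_right
  -- prime divisors of φ (sibling file, with `y = −b`, `a − (−b) = a + b`)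
  have hprimeφ : ∀ ℓ : ℕ, ℓ.Prime → (ℓ : ℤ) ∣ φ →
      (ℓ = r ∧ (ℓ : ℤ) ∣ s) ∨ (ℓ % r = 1 ∧ ¬ (ℓ : ℤ) ∣ s) := by
    intro ℓ hℓ hℓφ
    have := prime_dvd_geom_sum₂_int hr hℓ hab' hℓφ
    rwa [sub_neg_eq_add] at this
  -- `φ = r^e φ'`, `e ≤ 1`, `r ∤ φ'`, and `e = 1 ↔ r ∣ s`
  obtain ⟨e, φ', he, hφfac, hrφ', hes⟩ :
      ∃ e : ℕ, ∃ φ' : ℤ, e ≤ 1 ∧ φ = (r : ℤ) ^ e * φ' ∧ ¬ (r : ℤ) ∣ φ' ∧ (e = 1 ↔ (r : ℤ) ∣ s) := by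
    by_cases hrφ : (r : ℤ) ∣ φ
    · have hrs : (r : ℤ) ∣ s := by
        rcases hprimeφ r hr hrφ with ⟨-, h⟩ | ⟨h, -⟩
        · exact h
        · rw [Nat.mod_self] at h; exact absurd h zero_ne_one
      have hrb : ¬ (r : ℤ) ∣ -b := not_dvd_of_prime_dvd_geom_sum₂' hr.ne_zero hr hab' hrφ
      have hsq : ¬ (r : ℤ) ^ 2 ∣ φ :=
        sq_not_dvd_geom_sum₂_int hr hr2 (by rwa [sub_neg_eq_add]) hrb
      obtain ⟨φ', hφ'⟩ := hrφ
      refine ⟨1, φ', le_rfl, by rw [pow_one]; exact hφ', fun h => hsq ?_, by simp [hrs]⟩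
      obtain ⟨t, ht⟩ := h
      exact ⟨t, by rw [hφ', ht]; ring⟩
    · refine ⟨0, φ, zero_le_one, by rw [pow_zero, one_mul], hrφ, ?_⟩
      simp only [zero_ne_one, false_iff]
      intro hrs
      exact hrφ ((dvd_geom_sum₂_iff_of_dvd_sub (by rwa [sub_neg_eq_add])).mpr (dvd_mul_right _ _))
  have hφ'dvd : φ' ∣ φ := ⟨(r : ℤ) ^ e, by rw [hφfac, mul_comm]⟩
  have hφ'0 : φ' ≠ 0 := by rintro rfl; rw [mul_zero] at hφfac; exact hφpos.ne' hφfac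
  have hφ'pos : 0 < φ' := by
    have hpe : (0 : ℤ) < (r : ℤ) ^ e := pow_pos (by exact_mod_cast hr.pos) e
    rw [hφfac] at hφpos
    exact pos_of_mul_pos_right hφpos hpe.le
  -- primes of φ' : `≡ 1 (mod r)`, prime to `s` and to `C`
  have hprime : ∀ ℓ : ℕ, ℓ.Prime → (ℓ : ℤ) ∣ φ' → ℓ % r = 1 ∧ ¬ (ℓ : ℤ) ∣ s := by
    intro ℓ hℓ hℓφ'
    rcases hprimeφ ℓ hℓ (hℓφ'.trans hφ'dvd) with ⟨rfl, -⟩ | h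
    · exact absurd hℓφ' hrφ'
    · exact h
  have hcopC : IsCoprime φ' C :=
    isCoprime_of_forall_prime' fun ℓ hℓ h1 h2 => hC ℓ hℓ h2 (hprime ℓ hℓ h1).1
  -- `φ' ∣ c'^p`, `c'^p = φ' m`, `r^e s = C m`, `gcd(φ', m) = 1`
  have hφ'c : φ' ∣ c' ^ p :=
    hcopC.dvd_of_dvd_mul_left (hφmul ▸ hφ'dvd.trans (dvd_mul_right φ s))
  obtain ⟨m, hm⟩ := hφ'c
  have hrel : (r : ℤ) ^ e * s = C * m := by
    have h1 : φ' * ((r : ℤ) ^ e * s) = φ' * (C * m) := by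
      calc φ' * ((r : ℤ) ^ e * s) = φ * s := by rw [hφfac]; ring
        _ = C * c' ^ p := hφmul
        _ = φ' * (C * m) := by rw [hm]; ring
    exact mul_left_cancel₀ hφ'0 h1
  have hcopm : IsCoprime φ' m := by
    refine isCoprime_of_forall_prime' fun ℓ hℓ h1 h2 => ?_
    have hℓZ : Prime (ℓ : ℤ) := Nat.prime_iff_prime_int.mp hℓ
    have h3 : (ℓ : ℤ) ∣ (r : ℤ) ^ e * s := by rw [hrel]; exact dvd_mul_of_dvd_right h2 _
    rcases hℓZ.dvd_or_dvd h3 with h4 | h4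
    · have h5 : ℓ = r :=
        (Nat.prime_dvd_prime_iff_eq hℓ hr).mp (Int.natCast_dvd_natCast.mp (hℓZ.dvd_of_dvd_pow h4))
      subst h5
      exact hrφ' h1
    · exact (hprime ℓ hℓ h1).2 h4
  obtain ⟨c, hc⟩ : ∃ c : ℤ, φ' = c ^ p := eq_pow_of_mul_eq_pow_of_pos hp hcopm hm.symm hφ'pos
  refine ⟨c, ?_, fun q hq hqc => (hprime q hq (hc ▸ dvd_pow hqc hp.ne_zero)).1⟩
  interval_cases e
  · exact Or.inl ⟨by rw [hφfac, hc, pow_zero, one_mul], fun h => zero_ne_one (hes.mpr h)⟩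
  · exact Or.inr ⟨by rw [hφfac, hc, pow_one], hes.mp rfl⟩

/-! ## [Freitas2015, Prop. 2.5]: the solutions of `φ_r(x, y) = 1` and of `φ_r(x, y) = r` -/

/-- `G(x, y) = Σ_{i<r} x^i y^{r−1−i}` is unchanged under `(x, y) ↦ (−x, −y)` when `r` is odd (every term has even
total degree `r − 1`). [folklore] -/
private theorem geom_sum₂_neg_neg {r : ℕ} (hodd : Odd r) (x y : ℤ) :
    (∑ i ∈ range r, (-x) ^ i * (-y) ^ (r - 1 - i)) = ∑ i ∈ range r, x ^ i * y ^ (r - 1 - i) := by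
  refine sum_congr rfl fun i hi => ?_
  have hi' : i ≤ r - 1 := by have := mem_range.mp hi; omega
  have heven : Even (r - 1) := by obtain ⟨k, hk⟩ := hodd; exact ⟨k, by omega⟩
  calc (-x) ^ i * (-y) ^ (r - 1 - i) = ((-1) ^ i * (-1) ^ (r - 1 - i)) * (x ^ i * y ^ (r - 1 - i)) := by
          rw [neg_pow x, neg_pow y]; ring
    _ = x ^ i * y ^ (r - 1 - i) := by
          rw [← pow_add, show i + (r - 1 - i) = r - 1 by omega, heven.neg_one_pow, one_mul]

/-- If `x^r = x`, `y^r = y` (i.e. `x, y ∈ {−1, 0, 1}` for odd `r`) and `x ≠ y` then `G(x, y) = 1`, since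
`G(x, y)(x − y) = x^r − y^r = x − y`. [folklore] -/
private theorem geom_sum₂_eq_one_of_pow_eq_self {r : ℕ} {x y : ℤ} (hx : x ^ r = x) (hy : y ^ r = y)
    (hne : x ≠ y) : (∑ i ∈ range r, x ^ i * y ^ (r - 1 - i)) = 1 := by
  have h := geom_sum₂_mul x y r
  rw [hx, hy] at h
  exact mul_right_cancel₀ (sub_ne_zero.mpr hne) (by rw [h, one_mul])

/-- `t^r = t` for `|t| ≤ 1` and odd `r`. [folklore] -/
private theorem pow_eq_self_of_abs_le_one {r : ℕ} (hodd : Odd r) {t : ℤ} (ht : |t| ≤ 1) : t ^ r = t := by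
  have hr0 : r ≠ 0 := by obtain ⟨k, hk⟩ := hodd; omega
  obtain ⟨h1, h2⟩ := abs_le.mp ht
  interval_cases t
  · exact hodd.neg_one_pow
  · exact zero_pow hr0
  · exact one_pow r

/-- `r < 2^{r−1}` (as integers) for `r ≥ 3`. [folklore] -/
private theorem lt_two_pow_pred {r : ℕ} (h3 : 3 ≤ r) : (r : ℤ) < 2 ^ (r - 1) := by
  have h1 : r - 2 < 2 ^ (r - 2) := Nat.lt_two_pow_self
  have h2 : (2 : ℕ) ^ (r - 1) = 2 * 2 ^ (r - 2) := by rw [← pow_succ']; congr 1; omega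
  exact_mod_cast (show r < 2 ^ (r - 1) by omega)

/-- For `r ≥ 3` and `w ≥ 2`: `2^r − 2r ≤ w^r − r w`. [folklore] -/
private theorem pow_sub_mul_ge {r : ℕ} (h3 : 3 ≤ r) {w : ℤ} (hw : 2 ≤ w) :
    (2 : ℤ) ^ r - 2 * r ≤ w ^ r - r * w := by
  have h1 : (2 : ℤ) ^ (r - 1) ≤ w ^ (r - 1) := pow_le_pow_left₀ (by norm_num) hw (r - 1)
  have h2 : (r : ℤ) < 2 ^ (r - 1) := lt_two_pow_pred h3
  have h3' : w ^ r = w * w ^ (r - 1) := by rw [← pow_succ']; congr 1; omega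
  have h4 : (2 : ℤ) ^ r = 2 * 2 ^ (r - 1) := by rw [← pow_succ']; congr 1; omega
  rw [h3', h4]
  nlinarith

/-- For `r ≥ 5` and `u, v ≥ 0` with `max(u, v) ≥ 2`: `r(u + v) < u^r + v^r`. [folklore] -/
private theorem mul_add_lt_pow_add_pow {r : ℕ} (h5 : 5 ≤ r) {u v : ℤ} (hu : 0 ≤ u) (hv : 0 ≤ v)
    (hM : 2 ≤ u ∨ 2 ≤ v) : (r : ℤ) * (u + v) < u ^ r + v ^ r := by
  have h3 : 3 ≤ r := by omega
  have h2r : (2 : ℤ) * r < 2 ^ r := by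
    have := lt_two_pow_pred h3
    have h4 : (2 : ℤ) ^ r = 2 * 2 ^ (r - 1) := by rw [← pow_succ']; congr 1; omega
    rw [h4]; linarith
  -- `1 − r ≤ w^r − r w` for every `w ≥ 0`
  have hlow : ∀ w : ℤ, 0 ≤ w → 1 - (r : ℤ) ≤ w ^ r - r * w := by
    intro w hw
    rcases lt_trichotomy w 1 with h | rfl | h
    · obtain rfl : w = 0 := by omega
      rw [zero_pow (by omega), mul_zero, sub_zero]; omega
    · rw [one_pow, mul_one]
    · have := pow_sub_mul_ge h3 (show 2 ≤ w by omega)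
      linarith
  -- `3r ≤ 2^r`
  have h3r : 3 * (r : ℤ) ≤ 2 ^ r := by
    have h1 : r - 2 < 2 ^ (r - 2) := Nat.lt_two_pow_self
    have h2 : (2 : ℕ) ^ r = 4 * 2 ^ (r - 2) := by
      rw [show (4 : ℕ) = 2 ^ 2 by norm_num, ← pow_add]; congr 1; omega
    have : 3 * r ≤ 2 ^ r := by omega
    exact_mod_cast this
  rcases hM with hM | hM
  · have hA := pow_sub_mul_ge h3 hM
    have hB := hlow v hv
    nlinarith
  · have hA := pow_sub_mul_ge h3 hM
    have hB := hlow u hu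
    nlinarith

/-- Same-sign case: for `x, y ≥ 0` (`r ≥ 1`), `G(x, y) ≥ x^{r−1}` and `≥ y^{r−1}` (all terms are non-negative,
these are the two extreme ones). [folklore] -/
private theorem pow_le_geom_sum₂_of_nonneg {r : ℕ} (hr : 1 ≤ r) {x y : ℤ} (hx : 0 ≤ x) (hy : 0 ≤ y) :
    x ^ (r - 1) ≤ ∑ i ∈ range r, x ^ i * y ^ (r - 1 - i) ∧
      y ^ (r - 1) ≤ ∑ i ∈ range r, x ^ i * y ^ (r - 1 - i) := by
  have hnn : ∀ i ∈ range r, 0 ≤ x ^ i * y ^ (r - 1 - i) := fun i _ => by positivity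
  refine ⟨?_, ?_⟩
  · have h := single_le_sum hnn (mem_range.mpr (show r - 1 < r by omega))
    simpa [Nat.sub_self] using h
  · have h := single_le_sum hnn (mem_range.mpr (show 0 < r by omega))
    simpa using h

/-- Opposite-sign case: for `x ≥ 0 ≥ y`, `max(|x|, |y|) ≥ 2` and `r ≥ 5` odd: `G(x, y) > r`
(`G(x, y)(x + |y|) = x^r + |y|^r > r(x + |y|)`). [folklore] -/
private theorem lt_geom_sum₂_of_nonneg_nonpos {r : ℕ} (hodd : Odd r) (h5 : 5 ≤ r) {x y : ℤ}
    (hx : 0 ≤ x) (hy : y ≤ 0) (hM : 2 ≤ |x| ∨ 2 ≤ |y|) :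
    (r : ℤ) < ∑ i ∈ range r, x ^ i * y ^ (r - 1 - i) := by
  set G := ∑ i ∈ range r, x ^ i * y ^ (r - 1 - i) with hG
  set v := -y with hv
  have hv0 : 0 ≤ v := by omega
  have hkey : G * (x + v) = x ^ r + v ^ r := by
    have hmul : G * (x - y) = x ^ r - y ^ r := geom_sum₂_mul x y r
    rw [show y = -v by omega, hodd.neg_pow] at hmul
    linear_combination hmul
  have hM' : 2 ≤ x ∨ 2 ≤ v := by
    rcases hM with hM | hM
    · left; rwa [abs_of_nonneg hx] at hM
    · right; rwa [abs_of_nonpos hy] at hM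
  have hineq : (r : ℤ) * (x + v) < x ^ r + v ^ r := mul_add_lt_pow_add_pow h5 hx hv0 hM'
  have hpos : 0 < x + v := by
    rcases hM' with h | h <;> omega
  by_contra hle
  have hle' : G ≤ r := not_lt.mp hle
  nlinarith

/-- The size dichotomy behind [Freitas2015, Prop. 2.5]: for a prime `r ≥ 5` and integers `x, y` with
`max(|x|, |y|) ≥ 2`, `G(x, y) = Σ_{i<r} x^i y^{r−1−i} > r`. [folklore] -/
private theorem lt_geom_sum₂_of_two_le_abs {r : ℕ} (hr : r.Prime) (h5 : 5 ≤ r) {x y : ℤ}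
    (hM : 2 ≤ |x| ∨ 2 ≤ |y|) : (r : ℤ) < ∑ i ∈ range r, x ^ i * y ^ (r - 1 - i) := by
  have hodd : Odd r := hr.odd_of_ne_two (by omega)
  have h3 : 3 ≤ r := by omega
  rcases le_or_gt (x * y) 0 with hxy | hxy
  · -- opposite signs (or a zero): reduce to `x ≥ 0 ≥ y` by the symmetry `G(x, y) = G(y, x)`
    rcases mul_nonpos_iff.mp hxy with ⟨hx, hy⟩ | ⟨hx, hy⟩
    · exact lt_geom_sum₂_of_nonneg_nonpos hodd h5 hx hy hM
    · rw [geom_sum₂_comm]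
      exact lt_geom_sum₂_of_nonneg_nonpos hodd h5 hy hx hM.symm
  · -- same sign: `G(x, y) = G(|x|, |y|)` and the extreme terms dominate
    have hsame : (∑ i ∈ range r, x ^ i * y ^ (r - 1 - i)) =
        ∑ i ∈ range r, |x| ^ i * |y| ^ (r - 1 - i) := by
      rcases lt_or_gt_of_ne (show x ≠ 0 by rintro rfl; simp at hxy) with hx | hx
      · have hy : y < 0 := by nlinarith
        rw [abs_of_neg hx, abs_of_neg hy, geom_sum₂_neg_neg hodd]
      · have hy : 0 < y := by nlinarith
        rw [abs_of_pos hx, abs_of_pos hy]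
    rw [hsame]
    obtain ⟨h1, h2⟩ := pow_le_geom_sum₂_of_nonneg (show 1 ≤ r by omega) (abs_nonneg x) (abs_nonneg y)
    have h2pow : (r : ℤ) < 2 ^ (r - 1) := lt_two_pow_pred h3
    rcases hM with hM | hM
    · calc (r : ℤ) < 2 ^ (r - 1) := h2pow
        _ ≤ |x| ^ (r - 1) := pow_le_pow_left₀ (by norm_num) hM _
        _ ≤ _ := h1
    · calc (r : ℤ) < 2 ^ (r - 1) := h2pow
        _ ≤ |y| ^ (r - 1) := pow_le_pow_left₀ (by norm_num) hM _
        _ ≤ _ := h2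

/-- **[Freitas2015, Prop. 2.5]**, verbatim: "Let `r ≥ 5` be a prime. The equations `φ_r(x,y) = 1` and `φ_r(x,y) = r`
admit only the solutions `±(1,0)`, `±(0,1)`, `±(1,1)` and `±(1,−1)`, respectively." — i.e. `φ_r(a, b) = 1` iff
`(a, b) ∈ {±(1,0), ±(0,1), ±(1,1)}` and `φ_r(a, b) = r` iff `(a, b) = ±(1,−1)`, where
`φ_r(a, b) = Σ_{i<r} a^i (−b)^{r−1−i} = (a^r + b^r)/(a + b)`. (Proof: on the line `a = −b`, `φ_r = r a^{r−1}`; off it,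
`φ_r = 1` when `|a|, |b| ≤ 1` and `φ_r > r` as soon as `max(|a|, |b|) ≥ 2`.) [cite: Freitas2015, Prop. 2.5] -/
theorem freitas2015_prop25 {r : ℕ} (hr : r.Prime) (h5 : 5 ≤ r) (a b : ℤ) :
    ((∑ i ∈ range r, a ^ i * (-b) ^ (r - 1 - i)) = 1 ↔
      ((a = 1 ∨ a = -1) ∧ b = 0) ∨ (a = 0 ∧ (b = 1 ∨ b = -1)) ∨ (a = 1 ∧ b = 1) ∨ (a = -1 ∧ b = -1)) ∧
    ((∑ i ∈ range r, a ^ i * (-b) ^ (r - 1 - i)) = r ↔ (a = 1 ∧ b = -1) ∨ (a = -1 ∧ b = 1)) := by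
  have hodd : Odd r := hr.odd_of_ne_two (by omega)
  have heven : Even (r - 1) := by obtain ⟨k, hk⟩ := hodd; exact ⟨k, by omega⟩
  have hr1 : (1 : ℤ) < r := by exact_mod_cast hr.one_lt
  set G := ∑ i ∈ range r, a ^ i * (-b) ^ (r - 1 - i) with hG
  by_cases hline : a = -b
  · -- on the line `a + b = 0`: `G = r a^{r−1}`
    have hGr : G = r * a ^ (r - 1) := by rw [hG, hline]; exact geom_sum₂_self (-b) r
    have hb : b = -a := by rw [hline, neg_neg]
    have hapow : a ^ (r - 1) = |a| ^ (r - 1) := (heven.pow_abs a).symm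
    refine ⟨⟨fun h => ?_, fun h => ?_⟩, ⟨fun h => ?_, fun h => ?_⟩⟩
    · -- `r a^{r-1} = 1` is impossible
      exfalso
      rw [hGr] at h
      rcases eq_or_ne a 0 with rfl | ha
      · rw [zero_pow (by omega), mul_zero] at h; exact zero_ne_one h
      · have h1 : 1 ≤ |a| := Int.one_le_abs ha
        have h2 : (1 : ℤ) ≤ |a| ^ (r - 1) := one_le_pow₀ h1
        rw [hapow] at h; nlinarith
    · exfalso; rcases h with ⟨ha, hb0⟩ | ⟨ha0, hb1⟩ | ⟨ha1, hb1⟩ | ⟨ha1, hb1⟩ <;> omega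
    · rw [hGr] at h
      have hr0 : (r : ℤ) ≠ 0 := by positivity
      have h1 : a ^ (r - 1) = 1 := by
        have : (r : ℤ) * a ^ (r - 1) = r * 1 := by rw [h, mul_one]
        exact mul_left_cancel₀ hr0 this
      rw [hapow, pow_eq_one_iff_of_nonneg (abs_nonneg a) (by omega)] at h1
      rcases abs_eq (zero_le_one' ℤ) |>.mp h1 with ha | ha
      · left; exact ⟨ha, by rw [hb, ha]⟩
      · right; exact ⟨ha, by rw [hb, ha, neg_neg]⟩
    · rw [hGr]
      rcases h with ⟨rfl, rfl⟩ | ⟨rfl, rfl⟩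
      · rw [one_pow, mul_one]
      · rw [heven.neg_one_pow, mul_one]
  · -- off the line: `a ≠ −b`
    have hne : a ≠ -b := hline
    by_cases hsmall : |a| ≤ 1 ∧ |b| ≤ 1
    · -- `|a|, |b| ≤ 1`: `G = 1`
      have hG1 : G = 1 :=
        geom_sum₂_eq_one_of_pow_eq_self (pow_eq_self_of_abs_le_one hodd hsmall.1)
          (pow_eq_self_of_abs_le_one hodd (by rw [abs_neg]; exact hsmall.2)) hne
      obtain ⟨ha1, ha2⟩ := abs_le.mp hsmall.1
      obtain ⟨hb1, hb2⟩ := abs_le.mp hsmall.2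
      refine ⟨⟨fun _ => ?_, fun _ => hG1⟩, ⟨fun h => ?_, fun h => ?_⟩⟩
      · interval_cases a <;> interval_cases b <;> simp_all
      · exfalso; rw [hG1] at h; exact hr1.ne' h.symm
      · exfalso; rcases h with ⟨rfl, rfl⟩ | ⟨rfl, rfl⟩ <;> simp at hne
    · -- `max(|a|, |b|) ≥ 2`: `G > r > 1`
      have hM : 2 ≤ |a| ∨ 2 ≤ |-b| := by
        rw [abs_neg]
        rcases not_and_or.mp hsmall with h | h
        · left; omega
        · right; omega
      have hbig : (r : ℤ) < G := lt_geom_sum₂_of_two_le_abs hr h5 hM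
      refine ⟨⟨fun h => ?_, fun h => ?_⟩, ⟨fun h => ?_, fun h => ?_⟩⟩
      · exfalso; rw [h] at hbig; exact absurd hbig (not_lt.mpr hr1.le)
      · exfalso
        rw [abs_neg] at hM
        rcases h with ⟨ha, hb0⟩ | ⟨ha0, hb1⟩ | ⟨ha1, hb1⟩ | ⟨ha1, hb1⟩ <;>
          rcases hM with hM | hM <;> [rcases ha with rfl | rfl; skip; skip; rcases hb1 with rfl | rfl;
            skip; skip; skip; skip] <;> simp_all
      · exfalso; rw [h] at hbig; exact lt_irrefl _ hbig
      · exfalso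
        rw [abs_neg] at hM
        rcases h with ⟨rfl, rfl⟩ | ⟨rfl, rfl⟩ <;> rcases hM with hM | hM <;> simp at hM

end Literature.NumberTheory.DiophantineGeometry
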